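import Mathlib
import Summits.ValiantsHypothesis.ValiantsHypothesis.Theorems.NewtonUnitEquationsNewtonTauWeakCornerFibre

/-!
# `NewtonTauWeak` (stmt-ValiantsHypothesis-5904), line `binomial-normal-form`: the `K = 3` CORNER RIGIDITY
# LEMMA — direction-thickness `2` with coinciding subset sums

Third of three files (after `…CornerWords.lean`, `…CornerFibre.lean`).  SETTING (objects in `…CornerDefs.lean`):
directions `E : Fin s → ℤ²` of positive weight for a generic real weight `w` (`⟨w,·⟩` injective on `ℤ²`), pairwise
non-parallel rays; two separated products with univariate factors `U_e, W_e ∈ ℂ[s]`, `U_e(0) = W_e(0) = 1`,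
degrees `≤ D`; scalars `κ₁ + κ₂ = 1`, `κ₁κ₂ ≠ 0`; the coefficient of `z ∈ ℤ² ∖ 0` in
`κ₁ Π_e U_e(X^{E_e}) + κ₂ Π_e W_e(X^{E_e}) − 1` is `fibreSum … z`, the sum over ALL words of the box pushing
forward to `z` — fibres of the subset-sum map are arbitrary (coincidences allowed).

THEOREM (`corner_rigidity`, registered stub).  If `v ≠ 0` is OFF-ray, `fibreSum v ≠ 0`, and every lighter
nonzero lattice point has fibre sum `0` (so `v` is the `w`-initial exponent of the corner model), then
`v = o_{e₁}E_{e₁} + o_{e₂}E_{e₂}` for two distinct directions and the corner ORDERS of the factors `U_{e_i}` (or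
of the `W_{e_i}`), unless that sum is on a ray (escape clause; void under the global "no short 2-vs-1
relation" hypothesis of the line's count).  So the off-ray initial exponents of the `K = 3` corner model lie
among `≤ 2s²` explicit candidates of multiplicity `≤ D`: direction-thickness `K − 1 = 2` SURVIVES coinciding
subset sums at `K = 3`, whereas letter-thickness does not (`…CoincidenceDepth.lean`).  Proof: reduce to the
asymmetric core (`…CornerFibre.lean`) by comparing the mixed thresholds of the two sides (the model is
symmetric, `fibreSum_swap`); a side with fewer than two active directions has no mixed words.

Main result: `corner_rigidity`.  No definitions. [new for this line; KPTT arXiv:1308.2286 Conj. 1 context]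
-/

-- the namespace mandated for this Theorems file repeats the component `ValiantsHypothesis`
set_option linter.dupNamespace false

noncomputable section

open scoped BigOperators Polynomial

namespace Summit.ValiantsHypothesis.ValiantsHypothesis.Theorems.NewtonTauWeakCorner

/-! ## The corner rigidity lemma (symmetric statement) -/

/-- The fibre sum is symmetric in the two separated products. [folklore] -/
theorem fibreSum_swap {s : ℕ} (E : Fin s → Fin 2 → ℤ) (D : ℕ) (κ₁ κ₂ : ℂ) (U W : Fin s → ℂ[X])
    (z : Fin 2 → ℤ) : fibreSum E D κ₁ κ₂ U W z = fibreSum E D κ₂ κ₁ W U z := by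
  unfold fibreSum
  exact Finset.sum_congr rfl fun n _ => by ring

/-- Two nonzero letters of a word with nonzero separated coefficient give two active factors. [folklore] -/
theorem two_le_card_active {s : ℕ} (P : Fin s → ℂ[X]) {n : Fin s → ℕ} (hP : sepCoeff P n ≠ 0)
    (h2 : 2 ≤ (Finset.univ.filter fun x => n x ≠ 0).card) [DecidablePred fun e => Active (P e)] :
    2 ≤ (Finset.univ.filter fun e => Active (P e)).card := by
  refine h2.trans (Finset.card_le_card ?_)
  intro e he
  have hne0 : n e ≠ 0 := (Finset.mem_filter.mp he).2
  exact Finset.mem_filter.mpr ⟨Finset.mem_univ e,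
    active_of_coeff_ne_zero (Nat.one_le_iff_ne_zero.mpr hne0) (sepCoeff_ne_zero_apply hP e)⟩

/-- From the `U` side: if `U` has two active directions and `W`'s mixed words weigh at least `U`'s mixed
threshold, the conclusion of the corner lemma holds with `U`-orders. [this line; new] -/
theorem corner_from_U {s D : ℕ} (E : Fin s → Fin 2 → ℤ) (w : Fin 2 → ℝ)
    (hw : ∀ e, 0 < wt w (E e)) (hgen : Function.Injective (wt w))
    (hE : ∀ e e' : Fin s, ∀ k k' : ℕ, 1 ≤ k → (k : ℤ) • E e = (k' : ℤ) • E e' → e = e')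
    (κ₁ κ₂ : ℂ) (hκ : κ₁ + κ₂ = 1) (hκ₁ : κ₁ ≠ 0) (hκ₂ : κ₂ ≠ 0)
    (U W : Fin s → ℂ[X]) (hU0 : ∀ e, (U e).coeff 0 = 1) (hW0 : ∀ e, (W e).coeff 0 = 1)
    (hUD : ∀ e, (U e).natDegree ≤ D) (hWD : ∀ e, (W e).natDegree ≤ D)
    (o oW : Fin s → ℕ) (ho : ∀ e, Active (U e) → IsOrder (U e) (o e))
    (hoW : ∀ e, Active (W e) → IsOrder (W e) (oW e))
    [DecidablePred fun e => Active (U e)]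
    (hAU : 2 ≤ (Finset.univ.filter fun e => Active (U e)).card)
    (hWge : ∀ e₁ e₂ : Fin s, e₁ ≠ e₂ → Active (U e₁) → Active (U e₂) →
      (∀ e, Active (U e) → (o e₁ : ℝ) * wt w (E e₁) ≤ (o e : ℝ) * wt w (E e)) →
      (∀ e, e ≠ e₁ → Active (U e) → (o e₂ : ℝ) * wt w (E e₂) ≤ (o e : ℝ) * wt w (E e)) →
      ∀ n ∈ box s D, 2 ≤ (Finset.univ.filter fun x => n x ≠ 0).card → sepCoeff W n ≠ 0 →
        (o e₁ : ℝ) * wt w (E e₁) + (o e₂ : ℝ) * wt w (E e₂) ≤ wt w (push E n))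
    (v : Fin 2 → ℤ) (hv0 : v ≠ 0) (hoff : ¬ OnRay E v) (hv : fibreSum E D κ₁ κ₂ U W v ≠ 0)
    (hcanc : ∀ z, z ≠ 0 → wt w z < wt w v → fibreSum E D κ₁ κ₂ U W z = 0) :
    ∃ e₁ e₂ : Fin s, e₁ ≠ e₂ ∧ IsOrder (U e₁) (o e₁) ∧ IsOrder (U e₂) (o e₂) ∧
      (v = (o e₁ : ℤ) • E e₁ + (o e₂ : ℤ) • E e₂ ∨ OnRay E ((o e₁ : ℤ) • E e₁ + (o e₂ : ℤ) • E e₂)) := by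
  classical
  set AU := Finset.univ.filter fun e => Active (U e) with hAUdef
  have hAUne : AU.Nonempty := Finset.card_pos.mp (by omega)
  obtain ⟨e₁, he1, h1min⟩ := AU.exists_min_image (fun e => (o e : ℝ) * wt w (E e)) hAUne
  have hA1 : Active (U e₁) := (Finset.mem_filter.mp he1).2
  have hne' : (AU.erase e₁).Nonempty := Finset.card_pos.mp (by rw [Finset.card_erase_of_mem he1]; omega)
  obtain ⟨e₂, he2, h2min⟩ := (AU.erase e₁).exists_min_image (fun e => (o e : ℝ) * wt w (E e)) hne'
  have hne : e₁ ≠ e₂ := (Finset.ne_of_mem_erase he2).symm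
  have hA2 : Active (U e₂) := (Finset.mem_filter.mp (Finset.mem_of_mem_erase he2)).2
  have h1min' : ∀ e, Active (U e) → (o e₁ : ℝ) * wt w (E e₁) ≤ (o e : ℝ) * wt w (E e) :=
    fun e hAe => h1min e (Finset.mem_filter.mpr ⟨Finset.mem_univ e, hAe⟩)
  have h2min' : ∀ e, e ≠ e₁ → Active (U e) → (o e₂ : ℝ) * wt w (E e₂) ≤ (o e : ℝ) * wt w (E e) :=
    fun e hee hAe => h2min e (Finset.mem_erase.mpr ⟨hee, Finset.mem_filter.mpr ⟨Finset.mem_univ e, hAe⟩⟩)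
  refine ⟨e₁, e₂, hne, ho e₁ hA1, ho e₂ hA2, ?_⟩
  exact corner_core E w hw hgen hE κ₁ κ₂ hκ hκ₁ hκ₂ U W hU0 hW0 hUD hWD o oW ho hoW e₁ e₂ hne hA1 hA2
    h1min' h2min' (hWge e₁ e₂ hne hA1 hA2 h1min' h2min') v hv0 hoff hv hcanc

/-- **CORNER RIGIDITY LEMMA (`K = 3`, line `binomial-normal-form`, lead c2).**  The local model at a common
corner of three binomial products (after the flip identity and division by the lowest product,
`Cruxes/NewtonTauWeak/Lines/binomial-normal-form-ltc.md` §4): directions `E_e ∈ ℤ²` of positive weight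
for a generic real weight `w` (`⟨w,·⟩` injective on `ℤ²`), pairwise non-parallel rays (`hE`), two separated
products `Π_e U_e(X^{E_e})`, `Π_e W_e(X^{E_e})` with all `U_e(0) = W_e(0) = 1` and degrees `≤ D`, scalars
`κ₁ + κ₂ = 1`, `κ₁κ₂ ≠ 0` (the corner combination `κ₁U + κ₂W − 1` has no constant term), and the coefficient
of a lattice point `z ≠ 0` given by the fibre sum of the rank-two tensor over the word box (coinciding
subset sums ALLOWED: fibres may be arbitrary).  If an OFF-RAY point `v ≠ 0` carries a nonzero coefficient
while every lighter nonzero point is cancelled — i.e. `v` is the `w`-initial exponent of the corner model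
and is not on a ray — then `v` is the sum of the ORDER points `o_{e₁}E_{e₁} + o_{e₂}E_{e₂}` of two distinct
univariate factors of ONE of the two products (orders at the corner, so `o_e ≤ deg ≤ D`), unless that very
sum lies on a ray of the list (the escape clause is empty under the "no short 2-vs-1 relation" hypothesis
of the global count).  Consequently the off-ray initial exponents of the `K = 3` corner model range over
`≤ 2 s²` candidates, all of multiplicity `≤ D` — direction-thickness `2 = K − 1` WITH coincidences.
[this line; new — elementary proof: cancellation at the two lightest order points of `U` forces `W` to
share them with proportional coefficients, after which the coefficient at their sum is `κ₁u₁u₂/κ₂ ≠ 0`] -/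
theorem corner_rigidity {s D : ℕ} (E : Fin s → Fin 2 → ℤ) (w : Fin 2 → ℝ)
    (hw : ∀ e, 0 < wt w (E e)) (hgen : Function.Injective (wt w))
    (hE : ∀ e e' : Fin s, ∀ k k' : ℕ, 1 ≤ k → (k : ℤ) • E e = (k' : ℤ) • E e' → e = e')
    (κ₁ κ₂ : ℂ) (hκ : κ₁ + κ₂ = 1) (hκ₁ : κ₁ ≠ 0) (hκ₂ : κ₂ ≠ 0)
    (U W : Fin s → ℂ[X]) (hU0 : ∀ e, (U e).coeff 0 = 1) (hW0 : ∀ e, (W e).coeff 0 = 1)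
    (hUD : ∀ e, (U e).natDegree ≤ D) (hWD : ∀ e, (W e).natDegree ≤ D)
    (v : Fin 2 → ℤ) (hv0 : v ≠ 0) (hoff : ¬ OnRay E v) (hv : fibreSum E D κ₁ κ₂ U W v ≠ 0)
    (hcanc : ∀ z, z ≠ 0 → wt w z < wt w v → fibreSum E D κ₁ κ₂ U W z = 0) :
    ∃ e₁ e₂ : Fin s, e₁ ≠ e₂ ∧ ∃ k₁ k₂ : ℕ,
      ((IsOrder (U e₁) k₁ ∧ IsOrder (U e₂) k₂) ∨ (IsOrder (W e₁) k₁ ∧ IsOrder (W e₂) k₂)) ∧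
      (v = (k₁ : ℤ) • E e₁ + (k₂ : ℤ) • E e₂ ∨ OnRay E ((k₁ : ℤ) • E e₁ + (k₂ : ℤ) • E e₂)) := by
  classical
  -- order functions by choice
  let o : Fin s → ℕ := fun e => if h : Active (U e) then Classical.choose (exists_isOrder h) else 0
  let oW : Fin s → ℕ := fun e => if h : Active (W e) then Classical.choose (exists_isOrder h) else 0
  have ho : ∀ e, Active (U e) → IsOrder (U e) (o e) := by
    intro e h; simp only [o, dif_pos h]; exact Classical.choose_spec (exists_isOrder h)
  have hoW : ∀ e, Active (W e) → IsOrder (W e) (oW e) := by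
    intro e h; simp only [oW, dif_pos h]; exact Classical.choose_spec (exists_isOrder h)
  set AU := Finset.univ.filter fun e => Active (U e) with hAUdef
  set AW := Finset.univ.filter fun e => Active (W e) with hAWdef
  -- the general weight bounds of each side, packaged as "mixed threshold" functions
  -- symmetric data for the swapped problem
  have hκ' : κ₂ + κ₁ = 1 := by rw [add_comm]; exact hκ
  have hv' : fibreSum E D κ₂ κ₁ W U v ≠ 0 := by rwa [← fibreSum_swap]
  have hcanc' : ∀ z, z ≠ 0 → wt w z < wt w v → fibreSum E D κ₂ κ₁ W U z = 0 := by
    intro z hz hlt; rw [← fibreSum_swap]; exact hcanc z hz hlt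
  -- some contributing word: one side has two active directions
  have hside : 2 ≤ AU.card ∨ 2 ≤ AW.card := by
    unfold fibreSum at hv
    obtain ⟨n, hn, hsum⟩ := Finset.exists_ne_zero_of_sum_ne_zero hv
    obtain ⟨-, hpush⟩ := Finset.mem_filter.mp hn
    have h2 := two_le_card_of_offRay E hpush hv0 hoff
    by_cases hU : sepCoeff U n = 0
    · have hW : sepCoeff W n ≠ 0 := by intro hW; apply hsum; rw [hU, hW]; ring
      exact Or.inr (two_le_card_active W hW h2)
    · exact Or.inl (two_le_card_active U hU h2)
  -- the threshold inequality from a GENERAL weight bound on the other side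
  have key : ∀ (P Q : Fin s → ℂ[X]) (oP oQ : Fin s → ℕ),
      (∀ e, Active (P e) → IsOrder (P e) (oP e)) → (∀ e, Active (Q e) → IsOrder (Q e) (oQ e)) →
      ∀ e₁ e₂ : Fin s, e₁ ≠ e₂ → Active (P e₁) → Active (P e₂) →
      (∀ e, Active (P e) → (oP e₁ : ℝ) * wt w (E e₁) ≤ (oP e : ℝ) * wt w (E e)) →
      (∀ e, e ≠ e₁ → Active (P e) → (oP e₂ : ℝ) * wt w (E e₂) ≤ (oP e : ℝ) * wt w (E e)) →
      -- either `Q` has fewer than two active directions, or its two lightest weigh at least `P`'s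
      ((Finset.univ.filter fun e => Active (Q e)).card < 2 ∨
        ∃ f₁ f₂ : Fin s, f₁ ≠ f₂ ∧ Active (Q f₂) ∧
          (∀ e, Active (Q e) → (oQ f₁ : ℝ) * wt w (E f₁) ≤ (oQ e : ℝ) * wt w (E e)) ∧
          (∀ e, e ≠ f₁ → Active (Q e) → (oQ f₂ : ℝ) * wt w (E f₂) ≤ (oQ e : ℝ) * wt w (E e)) ∧
          (oP e₁ : ℝ) * wt w (E e₁) + (oP e₂ : ℝ) * wt w (E e₂)
            ≤ (oQ f₁ : ℝ) * wt w (E f₁) + (oQ f₂ : ℝ) * wt w (E f₂)) →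
      ∀ n ∈ box s D, 2 ≤ (Finset.univ.filter fun x => n x ≠ 0).card → sepCoeff Q n ≠ 0 →
        (oP e₁ : ℝ) * wt w (E e₁) + (oP e₂ : ℝ) * wt w (E e₂) ≤ wt w (push E n) := by
    intro P Q oP oQ hoP hoQ e₁ e₂ hne hA1 hA2 h1 h2 hQ n hn h2n hQn
    rcases hQ with hlt | ⟨f₁, f₂, hfne, hQ2, hf1, hf2, hle⟩
    · exact absurd (two_le_card_active Q hQn h2n) (by omega)
    · exact hle.trans (weight_ge_two_lightest E w hw hgen hE Q oQ hoQ f₁ f₂ hfne hQ2 hf1 hf2 n h2n hQn).1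
  -- two lightest active directions of a side with ≥ 2 active directions
  have lightest : ∀ (Q : Fin s → ℂ[X]) (oQ : Fin s → ℕ),
      2 ≤ (Finset.univ.filter fun e => Active (Q e)).card →
      ∃ f₁ f₂ : Fin s, f₁ ≠ f₂ ∧ Active (Q f₁) ∧ Active (Q f₂) ∧
        (∀ e, Active (Q e) → (oQ f₁ : ℝ) * wt w (E f₁) ≤ (oQ e : ℝ) * wt w (E e)) ∧
        (∀ e, e ≠ f₁ → Active (Q e) → (oQ f₂ : ℝ) * wt w (E f₂) ≤ (oQ e : ℝ) * wt w (E e)) := by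
    intro Q oQ hcard
    set AQ := Finset.univ.filter fun e => Active (Q e) with hAQ
    have hne1 : AQ.Nonempty := Finset.card_pos.mp (by omega)
    obtain ⟨f₁, hf1, hmin1⟩ := AQ.exists_min_image (fun e => (oQ e : ℝ) * wt w (E e)) hne1
    have hQ1 : Active (Q f₁) := (Finset.mem_filter.mp hf1).2
    have hne2 : (AQ.erase f₁).Nonempty :=
      Finset.card_pos.mp (by rw [Finset.card_erase_of_mem hf1]; omega)
    obtain ⟨f₂, hf2, hmin2⟩ := (AQ.erase f₁).exists_min_image (fun e => (oQ e : ℝ) * wt w (E e)) hne2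
    have hQ2 : Active (Q f₂) := (Finset.mem_filter.mp (Finset.mem_of_mem_erase hf2)).2
    refine ⟨f₁, f₂, (Finset.ne_of_mem_erase hf2).symm, hQ1, hQ2, ?_, ?_⟩
    · exact fun e hAe => hmin1 e (Finset.mem_filter.mpr ⟨Finset.mem_univ e, hAe⟩)
    · exact fun e hee hAe =>
        hmin2 e (Finset.mem_erase.mpr ⟨hee, Finset.mem_filter.mpr ⟨Finset.mem_univ e, hAe⟩⟩)
  -- the value of the two lightest is determined (any two choices give the same threshold): we avoid
  -- this by comparing thresholds of explicit choices on both sides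
  -- Case analysis
  by_cases hU2 : 2 ≤ AU.card
  · obtain ⟨e₁, e₂, hne, hA1, hA2, h1, h2⟩ := lightest U o hU2
    by_cases hW2 : 2 ≤ AW.card
    · obtain ⟨f₁, f₂, hfne, hB1, hB2, g1, g2⟩ := lightest W oW hW2
      by_cases hcmp : (o e₁ : ℝ) * wt w (E e₁) + (o e₂ : ℝ) * wt w (E e₂)
          ≤ (oW f₁ : ℝ) * wt w (E f₁) + (oW f₂ : ℝ) * wt w (E f₂)
      · -- work from the `U` side
        have hWge := key U W o oW ho hoW e₁ e₂ hne hA1 hA2 h1 h2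
          (Or.inr ⟨f₁, f₂, hfne, hB2, g1, g2, hcmp⟩)
        have := corner_core E w hw hgen hE κ₁ κ₂ hκ hκ₁ hκ₂ U W hU0 hW0 hUD hWD o oW ho hoW e₁ e₂ hne
          hA1 hA2 h1 h2 hWge v hv0 hoff hv hcanc
        exact ⟨e₁, e₂, hne, o e₁, o e₂, Or.inl ⟨ho e₁ hA1, ho e₂ hA2⟩, this⟩
      · -- work from the `W` side
        push Not at hcmp
        have hUge := key W U oW o hoW ho f₁ f₂ hfne hB1 hB2 g1 g2
          (Or.inr ⟨e₁, e₂, hne, hA2, h1, h2, hcmp.le⟩)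
        have := corner_core E w hw hgen hE κ₂ κ₁ hκ' hκ₂ hκ₁ W U hW0 hU0 hWD hUD oW o hoW ho f₁ f₂ hfne
          hB1 hB2 g1 g2 hUge v hv0 hoff hv' hcanc'
        exact ⟨f₁, f₂, hfne, oW f₁, oW f₂, Or.inr ⟨hoW f₁ hB1, hoW f₂ hB2⟩, this⟩
    · have hWge := key U W o oW ho hoW e₁ e₂ hne hA1 hA2 h1 h2 (Or.inl (by rw [← hAWdef]; omega))
      have := corner_core E w hw hgen hE κ₁ κ₂ hκ hκ₁ hκ₂ U W hU0 hW0 hUD hWD o oW ho hoW e₁ e₂ hne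
        hA1 hA2 h1 h2 hWge v hv0 hoff hv hcanc
      exact ⟨e₁, e₂, hne, o e₁, o e₂, Or.inl ⟨ho e₁ hA1, ho e₂ hA2⟩, this⟩
  · have hW2 : 2 ≤ AW.card := by rcases hside with h | h; exact absurd h hU2; exact h
    obtain ⟨f₁, f₂, hfne, hB1, hB2, g1, g2⟩ := lightest W oW hW2
    have hUge := key W U oW o hoW ho f₁ f₂ hfne hB1 hB2 g1 g2 (Or.inl (by rw [← hAUdef]; omega))
    have := corner_core E w hw hgen hE κ₂ κ₁ hκ' hκ₂ hκ₁ W U hW0 hU0 hWD hUD oW o hoW ho f₁ f₂ hfne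
      hB1 hB2 g1 g2 hUge v hv0 hoff hv' hcanc'
    exact ⟨f₁, f₂, hfne, oW f₁, oW f₂, Or.inr ⟨hoW f₁ hB1, hoW f₂ hB2⟩, this⟩

end Summit.ValiantsHypothesis.ValiantsHypothesis.Theorems.NewtonTauWeakCorner

end
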